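/-
Copyright: the b2b-balaban cell (near-miss cell 7), T⁴-continuum fan-out, round-2 swarm seat t4-ne7b-formalise-leaf-09
(row S3 of the lineage t4-ne7b-p1's claim table `t4/b2b-balaban-t4-ne7b-p1/LEAVES-NE7b.md`; node U5c COUNT member).
Released under the licence of the surrounding project.
-/
import Summits.QuantumFields.BalabanUV.T4Continuum.Support.HistoryGenTimed

/-!
# History genealogies, part 7: the part order — `HeadOldest` from the part list

Summits-side support leaf of the T⁴-continuum cell (rung (B)+1 on a FINITE torus only; NOT infinite volume, NOT the
mass gap, NOT the Clay statement; NOT a proof of the spine estimate NE7b).  Round-2 swarm `t4-ne7b-formalise-*`, row S3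
(seat leaf-09).  [folklore] finite bookkeeping over the lineage's OWN carrier; nothing printed is asserted; no
`[cite:]` tag.

WHY.  The assembly's `HistoryAssemblyPedigree.PedigreeReading.headOldest` (row S12) and part 4's `chronoC_genT` ∕ row
S4c's `wfLE_genT` ask `Pedigree.HeadOldest c` for every component — a statement about the part GENEALOGIES.  The
supplier knows the part LIST.  This file reduces one to the other.

WHAT.  `Pedigree.partRoot c p` (the root step of a part's line: `step c` for a new region, the old line's root step
otherwise), `rootStep_partGen_eq`, and **`headOldest_of_parts`**: if `parts c = p :: ps` with
`partRoot c p ≤ partRoot c q` for every `q ∈ ps` and `partRoot c p < step c` when `ps ≠ []` (for an all-new join use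
the virtual-step encoding of part 5, under which the head is an old part of the previous step), then `HeadOldest c`.
Also `partRoot_old_lt` (an old part's line is born before `step c`) and **`headOldest_of_oldHead`** (head an OLD part
born no later than every other part's line ⇒ `HeadOldest c`).

HONEST DEPENDENCY (cell): continuum YM on T⁴ ⇐ BetaPertH ∧ nine spine estimates (0/9 proved); BetaPertH ⇐ (D1) ∧ (D4)
∧ CAP+tail.  This file changes none of it.
-/

open Finset
open Literature.MathematicalPhysics.QuantumFieldTheory.Balaban1983to89
open T4PersistenceDictionary

namespace Summit.QuantumFields.BalabanUV.T4Continuum.HistoryGen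

namespace Pedigree

variable {α π : Type*} (P : Pedigree α π)

/-- **THE ROOT STEP OF A PART'S LINE**: the step of `c` for a new region, the old line's root step otherwise. [folklore] -/
def partRoot (c : α) : Part α π → ℕ
  | Part.new _ _ => P.step c
  | Part.old c' _ => (P.genT c').rootStep

variable {P}

/-- the root step of a part genealogy is `partRoot` [folklore] -/
theorem rootStep_partGen_eq (c : α) (i : ℕ) (p : Part α π) : (P.partGen c P.genT i p).rootStep = P.partRoot c p := by
  rcases p with ⟨c', _ | _⟩ | ⟨d, x⟩ <;> rfl

/-- an old part's line is born strictly before the step of the component it enters [folklore] -/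
theorem partRoot_old_lt {c c' : α} {r : Bool} (h : Part.old c' r ∈ P.parts c) : P.partRoot c (Part.old c' r) < P.step c :=
  (P.rootStep_genT_le c').trans_lt (P.step_lt c c' r h)

/-- a part's line is born no later than the step of the component [folklore] -/
theorem partRoot_le (c : α) {p : Part α π} (hp : p ∈ P.parts c) : P.partRoot c p ≤ P.step c := by
  rcases p with ⟨c', r⟩ | ⟨d, x⟩
  · exact (partRoot_old_lt hp).le
  · exact le_rfl

/-- **`HeadOldest` FROM THE PART LIST**: the head part's line is born no later than every other part's line, and
strictly before the step of `c` when there are several parts. [folklore] -/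
theorem headOldest_of_parts {c : α} {p : Part α π} {ps : List (Part α π)} (hps : P.parts c = p :: ps)
    (hle : ∀ q ∈ ps, P.partRoot c p ≤ P.partRoot c q) (hlt : ps ≠ [] → P.partRoot c p < P.step c) :
    P.HeadOldest c := by
  intro G Gs hG
  unfold Pedigree.partsGen at hG
  rw [hps, partsGenAux_cons, List.cons.injEq] at hG
  obtain ⟨rfl, rfl⟩ := hG
  refine ⟨fun H hH => ?_, fun hne => ?_⟩
  · obtain ⟨k, q, hq, rfl⟩ := P.mem_partsGenAux hH
    rw [rootStep_partGen_eq, rootStep_partGen_eq]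
    exact hle q hq
  · rw [rootStep_partGen_eq]
    refine hlt ?_
    rintro rfl
    exact hne (by simp)

/-- **OLD HEAD, OLDEST LINE**: if the head part is an OLD component whose line is born no later than every other
part's line, then `HeadOldest c` (the strict clause is automatic for an old head). [folklore] -/
theorem headOldest_of_oldHead {c c' : α} {r : Bool} {ps : List (Part α π)} (hps : P.parts c = Part.old c' r :: ps)
    (hle : ∀ q ∈ ps, (P.genT c').rootStep ≤ P.partRoot c q) : P.HeadOldest c :=
  headOldest_of_parts hps hle fun _ => partRoot_old_lt (by rw [hps]; exact List.mem_cons_self)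

/-- a single-part component is trivially `HeadOldest` [folklore] -/
theorem headOldest_of_single {c : α} {p : Part α π} (hps : P.parts c = [p]) : P.HeadOldest c :=
  headOldest_of_parts hps (fun _ h => by simp at h) fun h => absurd rfl h

/-- a partless component is trivially `HeadOldest` [folklore] -/
theorem headOldest_of_nil {c : α} (hps : P.parts c = []) : P.HeadOldest c := by
  intro G Gs hG
  unfold Pedigree.partsGen at hG
  rw [hps, partsGenAux_nil] at hG
  exact absurd hG (by simp)

end Pedigree

end Summit.QuantumFields.BalabanUV.T4Continuum.HistoryGen
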